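import Summits.CriticalPhenomena.PercolationContinuityZ3.Theorems.PercNearOneGluingNoHeavyLowerTailThreePointProductFormFibreTreeProductForm
import HarnessLib

/-!
# (P) on tree-like fibres, VI: the concrete tree theorem (Sahi programme, prover prim-sahi-p2 gen 60)

Support file (`--supports stmt-CriticalPhenomena-4575`, helper).  Standard axioms, no sorries, no named facts, no definitions.
Memo `run/shared/lean/prim/prim-sahi/FROM-prim-sahi-p2-gen60-CYCLE-LEMMA.md` §6; `prim-sahi-p2/PROOF-E3.md` §70.

`productForm_of_treeStructure` (`…FibreTreeProductForm`, gen 59) proves CONJECTURE (P) `#bad² ≤ #P1·#P2` at every vertex of an ABSTRACT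
tree structure (trunk `T`, children `ch`, heights `ht`, masks `mQ`, private classes `Sv`, …).  This file discharges the abstract hypotheses for
a CONCRETE finite multigraph `(V, α, ends)` whose trunk `H − {s,c}` is a tree through the apex `a`, presented by PARENT POINTERS:
a finite set `T ∌ s, c` of trunk vertices with `a ∈ T`, a parent map `par` and a depth `dep` (`dep a = 0`, and for
`v ∈ T ∖ {a}`: `par v ∈ T`, `dep (par v) + 1 = dep v`), the trunk label `e v : par v — v` of each `v ∈ T ∖ {a}`, and the requirement that
EVERY label is either such a trunk label or a MARK `x — s` / `x — c` at a trunk vertex `x ∈ T` (any number of parallel marks).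

* §1 iterated parents: `par^[n] x ∈ T`, `dep (par^[n] x) + n = dep x`, `par^[dep x] x = a`; the ancestor relation
  `Anc v x :⟺ dep v ≤ dep x ∧ par^[dep x − dep v] x = v` is reflexive and transitive, a proper ancestor passes through a unique child.
* §2 **`productForm_of_treeParent`**: `#{a|s|c, s ↔ c in ♭z}² ≤ #{a ↔ s, a ↮ c} · #{a ↔ c, a ↮ s}` for such multigraphs — CONJECTURE (P)
  for every fibre whose trunk is a tree through the apex with simple trunk labels (claws, spiders, `K_{3,k}`-fans, caterpillars with `s,c`
  attached anywhere, …), now as a statement about the multigraph itself.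
[this work] (gen 60); [cite: Gladkov2024, Conjecture 10.1 (p. 18), arXiv:2408.08457] for (P) and its consequences.
-/

namespace Summit.CriticalPhenomena.PercolationContinuityZ3.Theorems.ProductFormFibre

open Finset Literature.Probability.Percolation
open Summit.CriticalPhenomena.PercolationContinuityZ3.Theorems.ThreePointCPIClusterSwap (clusterFlip)

variable {V α : Type*}

/-! ### §1. Iterated parents in a parent-pointer tree -/

section Parents

variable (T : Finset V) (a : V) (par : V → V) (dep : V → ℕ)

/-- Iterating the parent map `n ≤ dep x` times from a trunk vertex stays in the trunk and lowers the depth by exactly `n`. [this work] -/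
theorem iterate_par_mem (hda : dep a = 0)
    (hdep : ∀ v ∈ T, v ≠ a → par v ∈ T ∧ dep (par v) + 1 = dep v) :
    ∀ (n : ℕ) (x : V), x ∈ T → n ≤ dep x → par^[n] x ∈ T ∧ dep (par^[n] x) + n = dep x := by
  intro n
  induction n with
  | zero => intro x hx _; exact ⟨by simpa using hx, by simp⟩
  | succ n ih =>
    intro x hx hn
    obtain ⟨h1, h2⟩ := ih x hx (Nat.le_of_succ_le hn)
    have hne : par^[n] x ≠ a := by
      intro h
      rw [h, hda] at h2
      omega
    obtain ⟨h3, h4⟩ := hdep _ h1 hne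
    refine ⟨?_, ?_⟩
    · rw [Function.iterate_succ_apply']; exact h3
    · rw [Function.iterate_succ_apply']; omega

/-- Iterating the parent map `dep x` times reaches the root. [this work] -/
theorem iterate_par_dep (hda : dep a = 0)
    (hdep : ∀ v ∈ T, v ≠ a → par v ∈ T ∧ dep (par v) + 1 = dep v) (x : V) (hx : x ∈ T) :
    par^[dep x] x = a := by
  obtain ⟨h1, h2⟩ := iterate_par_mem T a par dep hda hdep (dep x) x hx le_rfl
  by_contra hne
  have := (hdep _ h1 hne).2
  omega

/-- Reflexivity of the ancestor relation. [this work] -/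
theorem anc_refl (x : V) : dep x ≤ dep x ∧ par^[dep x - dep x] x = x := ⟨le_rfl, by simp⟩

/-- Transitivity of the ancestor relation. [this work] -/
theorem anc_trans {v u x : V} (h1 : dep v ≤ dep u ∧ par^[dep u - dep v] u = v) (h2 : dep u ≤ dep x ∧ par^[dep x - dep u] x = u) :
    dep v ≤ dep x ∧ par^[dep x - dep v] x = v := by
  refine ⟨h1.1.trans h2.1, ?_⟩
  have : dep x - dep v = (dep u - dep v) + (dep x - dep u) := by omega
  rw [this, Function.iterate_add_apply, h2.2, h1.2]

/-- A proper ancestor `v` of `x` is reached through a unique child `u₁ = par^[dep x − dep v − 1] x` of `v`, which is an ancestor of `x`.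
[this work] -/
theorem anc_child (hda : dep a = 0)
    (hdep : ∀ v ∈ T, v ≠ a → par v ∈ T ∧ dep (par v) + 1 = dep v) {v x : V} (hx : x ∈ T)
    (h : dep v ≤ dep x ∧ par^[dep x - dep v] x = v) (hne : x ≠ v) :
    let u₁ := par^[dep x - dep v - 1] x
    u₁ ∈ T ∧ u₁ ≠ a ∧ par u₁ = v ∧ dep u₁ = dep v + 1 ∧ (dep u₁ ≤ dep x ∧ par^[dep x - dep u₁] x = u₁) := by
  intro u₁
  have hlt : dep v < dep x := by
    rcases Nat.lt_or_ge (dep v) (dep x) with hl | hl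
    · exact hl
    · exfalso
      have h0 : dep x - dep v = 0 := by omega
      rw [h0] at h; simp at h; exact hne h.2
  obtain ⟨hm, hd⟩ := iterate_par_mem T a par dep hda hdep (dep x - dep v - 1) x hx (by omega)
  have hpar : par u₁ = v := by
    show par (par^[dep x - dep v - 1] x) = v
    rw [← Function.iterate_succ_apply' par]
    have : dep x - dep v - 1 + 1 = dep x - dep v := by omega
    rw [Nat.succ_eq_add_one, this]; exact h.2
  have hdu : dep u₁ = dep v + 1 := by
    show dep (par^[dep x - dep v - 1] x) = dep v + 1
    omega
  refine ⟨hm, ?_, hpar, hdu, ?_, ?_⟩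
  · intro hu; rw [hu, hda] at hdu; omega
  · omega
  · have : dep x - dep u₁ = dep x - dep v - 1 := by omega
    rw [this]

end Parents

/-! ### §2. The concrete tree theorem -/

section Concrete

variable [Fintype α] [DecidableEq α] [Fintype V] [DecidableEq V] (ends : α → Sym2 V) (s c a : V)
  (T : Finset V) (par : V → V) (dep : V → ℕ) (e : V → α)

open Classical in
/-- **CONJECTURE (P) FOR EVERY FIBRE WHOSE TRUNK IS A TREE THROUGH THE APEX** (parent-pointer form).  Let `T ∌ s, c` be a finite set of
trunk vertices containing the apex `a`, with parent map `par` and depth `dep` (`dep a = 0`; `par v ∈ T` and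
`dep (par v) + 1 = dep v` for `v ∈ T ∖ {a}`), let `e v` be a label `par v — v` for each `v ∈ T ∖ {a}`, and suppose EVERY label of the
multigraph is either one of these trunk labels or a mark `x — s` / `x — c` at some `x ∈ T`.  Then
`#{a ↮ s, a ↮ c, s ↮ c in z, s ↔ c in ♭z}² ≤ #{a ↔ s, a ↮ c} · #{a ↔ c, a ↮ s}` with `♭z = clusterFlip ends a z̄`. [this work] -/
theorem productForm_of_treeParent (hsc : s ≠ c) (hsT : s ∉ T) (hcT : c ∉ T) (haT : a ∈ T)
    (hda : dep a = 0)
    (hdep : ∀ v ∈ T, v ≠ a → par v ∈ T ∧ dep (par v) + 1 = dep v)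
    (he : ∀ v ∈ T, v ≠ a → ends (e v) = s(par v, v))
    (hlab : ∀ l, (∃ v ∈ T, v ≠ a ∧ l = e v) ∨ (∃ x ∈ T, ends l = s(x, s) ∨ ends l = s(x, c))) :
    (univ.filter fun z : α → Bool =>
        (¬ (openGraph (labelledOpen ends z)).Reachable a s ∧ ¬ (openGraph (labelledOpen ends z)).Reachable a c ∧
          ¬ (openGraph (labelledOpen ends z)).Reachable s c) ∧
        (openGraph (labelledOpen ends (clusterFlip ends a fun x => !z x))).Reachable s c).card ^ 2 ≤
    (univ.filter fun z : α → Bool =>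
        (openGraph (labelledOpen ends z)).Reachable a s ∧ ¬ (openGraph (labelledOpen ends z)).Reachable a c).card *
    (univ.filter fun z : α → Bool =>
        (openGraph (labelledOpen ends z)).Reachable a c ∧ ¬ (openGraph (labelledOpen ends z)).Reachable a s).card := by
  -- the ancestor relation and the concrete tree structure
  let Anc : V → V → Prop := fun v x => x ∈ T ∧ v ∈ T ∧ dep v ≤ dep x ∧ par^[dep x - dep v] x = v
  let Tp : V → Prop := fun v => v ∈ T
  let ch : V → Finset V := fun v => T.filter fun u => u ≠ a ∧ par u = v
  let M : ℕ := T.sup dep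
  let ht : V → ℕ := fun v => M - dep v
  let Ms : V → Finset α := fun v => univ.filter fun l => ends l = s(v, s)
  let Mc : V → Finset α := fun v => univ.filter fun l => ends l = s(v, c)
  let mQ : V → α → Bool := fun v l =>
    decide ((∃ u ∈ T, u ≠ a ∧ l = e u ∧ Anc v u ∧ u ≠ v) ∨ (∃ x, Anc v x ∧ (ends l = s(x, s) ∨ ends l = s(x, c))))
  have anc_refl' : ∀ x ∈ T, Anc x x := fun x hx => ⟨hx, hx, le_rfl, by simp⟩
  have anc_trans' : ∀ {v u x}, Anc v u → Anc u x → Anc v x := by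
    intro v u x h1 h2
    exact ⟨h2.1, h1.2.1, anc_trans par dep ⟨h1.2.2.1, h1.2.2.2⟩ ⟨h2.2.2.1, h2.2.2.2⟩⟩
  have mem_ch : ∀ v u, u ∈ ch v ↔ u ∈ T ∧ u ≠ a ∧ par u = v := by
    intro v u; simp only [ch, Finset.mem_filter]
  have dep_ch : ∀ v, v ∈ T → ∀ u ∈ ch v, dep u = dep v + 1 := by
    intro v hv u hu
    obtain ⟨huT, hua, hpu⟩ := (mem_ch v u).mp hu
    have := (hdep u huT hua).2; rw [hpu] at this; omega
  have anc_of_ch : ∀ v, v ∈ T → ∀ u ∈ ch v, Anc v u := by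
    intro v hv u hu
    obtain ⟨huT, hua, hpu⟩ := (mem_ch v u).mp hu
    have hd := dep_ch v hv u hu
    refine ⟨huT, hv, by omega, ?_⟩
    have : dep u - dep v = 1 := by omega
    rw [this]; simpa using hpu
  -- a proper ancestor passes through a child
  have anc_child' : ∀ {v x}, Anc v x → x ≠ v → ∃ u ∈ ch v, Anc u x := by
    intro v x h hne
    obtain ⟨hm, hna, hpar, hdu, hanc⟩ := anc_child T a par dep hda hdep h.1 ⟨h.2.2.1, h.2.2.2⟩ hne
    exact ⟨_, (mem_ch v _).mpr ⟨hm, hna, hpar⟩, h.1, hm, hanc⟩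
  -- the recursive description of the masks
  have hmQ : ∀ v, Tp v → ∀ l, (mQ v l = true ↔ (∃ u ∈ ch v, l = e u ∨ mQ u l = true) ∨ l ∈ Ms v ∨ l ∈ Mc v) := by
    intro v hv l
    simp only [mQ, decide_eq_true_eq, Ms, Mc, Finset.mem_filter, Finset.mem_univ, true_and]
    constructor
    · rintro (⟨u, huT, hua, rfl, hanc, hne⟩ | ⟨x, hanc, hl⟩)
      · -- trunk label below v
        obtain ⟨u₁, hu₁, h1⟩ := anc_child' hanc hne
        by_cases hu1 : u = u₁
        · subst hu1; exact Or.inl ⟨u, hu₁, Or.inl rfl⟩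
        · exact Or.inl ⟨u₁, hu₁, Or.inr (Or.inl ⟨u, huT, hua, rfl, h1, hu1⟩)⟩
      · by_cases hxv : x = v
        · subst hxv
          rcases hl with hl | hl
          · exact Or.inr (Or.inl hl)
          · exact Or.inr (Or.inr hl)
        · obtain ⟨u₁, hu₁, h1⟩ := anc_child' hanc hxv
          exact Or.inl ⟨u₁, hu₁, Or.inr (Or.inr ⟨x, h1, hl⟩)⟩
    · rintro (⟨u, hu, hl⟩ | hl | hl)
      · have hvu := anc_of_ch v hv u hu
        have hdu := dep_ch v hv u hu
        obtain ⟨huT, hua, hpu⟩ := (mem_ch v u).mp hu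
        rcases hl with rfl | (⟨u', hu'T, hu'a, rfl, hanc, hne⟩ | ⟨x, hanc, hl⟩)
        · exact Or.inl ⟨u, huT, hua, rfl, hvu, fun h => by rw [h] at hdu; omega⟩
        · refine Or.inl ⟨u', hu'T, hu'a, rfl, anc_trans' hvu hanc, fun h => ?_⟩
          rw [h] at hanc; have := hanc.2.2.1; omega
        · exact Or.inr ⟨x, anc_trans' hvu hanc, hl⟩
      · exact Or.inr ⟨v, anc_refl' v hv, Or.inl hl⟩
      · exact Or.inr ⟨v, anc_refl' v hv, Or.inr hl⟩
  have key := productForm_of_treeStructure ends s c Tp ch ht mQ Anc e Ms Mc hsc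
    (fun v hv => ⟨fun h => hsT (h ▸ hv), fun h => hcT (h ▸ hv)⟩)
    (fun v hv u hu => by
      obtain ⟨huT, hua, hpu⟩ := (mem_ch v u).mp hu
      have hd := dep_ch v hv u hu
      have hM : dep u ≤ M := Finset.le_sup (f := dep) huT
      exact ⟨huT, by show M - dep u < M - dep v; omega⟩)
    (fun v hv u hu => by
      obtain ⟨huT, hua, hpu⟩ := (mem_ch v u).mp hu
      rw [he u huT hua, hpu])
    (fun v hv m hm => by simpa [Ms] using hm) (fun v hv m hm => by simpa [Mc] using hm)
    hmQ
    (fun u hu => anc_refl' u hu)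
    (fun u hu l hl => by
      simp only [mQ, decide_eq_true_eq] at hl
      rcases hl with ⟨u', hu'T, hu'a, rfl, hanc, hne⟩ | ⟨x, hanc, hl⟩
      · -- the trunk label `e u'` with `u'` strictly below `u`: both endpoints are below `u`
        have hpar' : Anc u (par u') := by
          obtain ⟨hm, hna, hpar, hdu, hanc1⟩ := anc_child T a par dep hda hdep hanc.1 ⟨hanc.2.2.1, hanc.2.2.2⟩ hne
          -- `par u'` is the ancestor of `u'` one level up; it is below `u`
          have h1 : Anc (par u') u' := by
            refine ⟨hu'T, (hdep u' hu'T hu'a).1, by have := (hdep u' hu'T hu'a).2; omega, ?_⟩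
            have : dep u' - dep (par u') = 1 := by have := (hdep u' hu'T hu'a).2; omega
            rw [this]; simp
          -- `u` is an ancestor of `u'` different from `u'`, so an ancestor of `par u'`
          refine ⟨(hdep u' hu'T hu'a).1, hanc.2.1, ?_, ?_⟩
          · have := (hdep u' hu'T hu'a).2
            rcases Nat.lt_or_ge (dep u) (dep u') with h | h
            · omega
            · exfalso
              have h0 : dep u' - dep u = 0 := by omega
              have := hanc.2.2.2; rw [h0] at this; simp at this; exact hne this
          · have hd := (hdep u' hu'T hu'a).2
            have : dep (par u') - dep u = (dep u' - dep u) - 1 := by omega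
            rw [this]
            have h2 := hanc.2.2.2
            have hk : dep u' - dep u = (dep u' - dep u - 1) + 1 := by
              rcases Nat.lt_or_ge (dep u) (dep u') with h | h
              · omega
              · exfalso
                have h0 : dep u' - dep u = 0 := by omega
                rw [h0] at h2; simp at h2; exact hne h2
            rw [hk, Function.iterate_succ_apply] at h2
            exact h2
        rw [he u' hu'T hu'a]
        refine ⟨fun x hx => ?_, ⟨u', Sym2.mem_mk_right _ _, hanc⟩⟩
        rcases Sym2.mem_iff.mp hx with rfl | rfl
        · exact Or.inl hpar'
        · exact Or.inl hanc
      · rcases hl with hl | hl <;> rw [hl]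
        · exact ⟨fun y hy => by
            rcases Sym2.mem_iff.mp hy with rfl | rfl
            · exact Or.inl hanc
            · exact Or.inr (Or.inl rfl), ⟨x, Sym2.mem_mk_left _ _, hanc⟩⟩
        · exact ⟨fun y hy => by
            rcases Sym2.mem_iff.mp hy with rfl | rfl
            · exact Or.inl hanc
            · exact Or.inr (Or.inr rfl), ⟨x, Sym2.mem_mk_left _ _, hanc⟩⟩)
    (fun u hu x hx => ⟨fun h => hsT (h ▸ hx.1), fun h => hcT (h ▸ hx.1)⟩)
    (fun v hv u hu x hx => by
      intro hxv
      have hd := dep_ch v hv u hu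
      have := hx.2.2.1; rw [hxv] at this; omega)
    (fun v hv u hu u' hu' hne x hx hx' => by
      have hd := dep_ch v hv u hu
      have hd' := dep_ch v hv u' hu'
      have h1 := hx.2.2.2; have h2 := hx'.2.2.2
      rw [hd] at h1; rw [hd'] at h2
      exact hne (h1.symm.trans h2))
    a haT
  -- every label lies below the apex
  have anc_a : ∀ x ∈ T, Anc a x := by
    intro x hx
    refine ⟨hx, haT, by rw [hda]; exact Nat.zero_le _, ?_⟩
    rw [hda, Nat.sub_zero]; exact iterate_par_dep T a par dep hda hdep x hx
  have hmQa : ∀ l, mQ a l = true := by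
    intro l
    simp only [mQ, decide_eq_true_eq]
    rcases hlab l with ⟨v, hv, hva, rfl⟩ | ⟨x, hx, hl⟩
    · exact Or.inl ⟨v, hv, hva, rfl, anc_a v hv, hva⟩
    · exact Or.inr ⟨x, anc_a x hx, hl⟩
  simp only [hmQa, Bool.and_true] at key
  have hflip : ∀ z : α → Bool, (fun l => clusterFlip ends a (fun y => !z y) l) = clusterFlip ends a (fun y => !z y) := fun z => rfl
  convert key using 3

end Concrete

end Summit.CriticalPhenomena.PercolationContinuityZ3.Theorems.ProductFormFibre
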